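import Summits.CriticalPhenomena.PercolationContinuityZ3.Theorems.PercNearOneGluingNoHeavyQuantTwoArmVsHalfSpaceArm
import Summits.CriticalPhenomena.PercolationContinuityZ3.Theorems.PercNearOneGluingNoHeavyQuantUniqZoneCritical
import Summits.CriticalPhenomena.PercolationContinuityZ3.Theorems.QuantitativeBGN.Negative.ArmLowerBound
import HarnessLib

/-!
# QUANT lane (R6/O1): the typed input `(X2)` bridged to the tree's half-space arm `armH` and calibrated at `p_c(ℤ³)`

builds on p205010 (kernel theorem, internal audit signed; external expert review pending)

Cell `prim-quant` (post-continuity programme, LANE 1), seat `prim-quant-p2` (METHOD = effective Kozma–Nitzan reduction),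
memo `run/shared/lean/prim/quant/P2-EFFECTIVE-KN.md` §7.4 / §8; postcont `QUANT.md` §13(a).

`Quant.halfSpaceArm 3 M` (the event of the typed open input `Quant.TwoArmVsHalfSpaceArmAt`, p211163) is BY DEFINITION
the event `QuantitativeBGN.Negative.armH M` of the crux `QuantitativeBGN` (stmt-CriticalPhenomena-0913), for which the
tree PROVES the lower bound `1/(588 (n+1)²) ≤ P_{p_c(ℤ³)}(armH (n+1))` (`armH_lower_bound`, from `φ_{p_c}(Λ_{n+1}) ≥ 1`).
Consequences recorded here (all unconditional, `d = 3`, at `p = p_c`):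
* `halfSpaceArm_three_eq_armH` (`rfl`) and `real_halfSpaceArm_three_criticalProbI_ge : 1/(588 M²) ≤ P_{p_c}(halfSpaceArm 3 M)`;
* `twoArmVsHalfSpaceArmAt_three_criticalProbI_of_le` : an ABSOLUTE non-uniqueness bound `P_{p_c}((uniqZone m M)ᶜ) ≤ c/(588 M²)`
  implies `(X2)` at `(m, M, c)` — the "provable floor" route (LEAD-NOTES N6), whose hypothesis with `c` constant amounts to a
  box-two-arm exponent `> 2`, expected FALSE in `d = 3` (scaling value `d − 1/ν ≈ 1.86`, postcont QUANT §12.4/§13(a));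
* `twoArmVsHalfSpaceArmAt_three_criticalProbI_dkt` : with DKT's Proposition 1 (explicit: exponent `dktAlpha 3 = 1/220`,
  threshold `dktN1 3 (critDelta 3)`) the constant the tree can certify TODAY is `c(M) = 588 · M^{2 − dktAlpha 3}`, i.e.
  `(X2)` HOLDS at `p_c(ℤ³)` for `M ≥ dktN1 3 (critDelta 3)`, `m ≤ ⌊M^{1/220}⌋`, with `c(M) = 588 M^{439/220}`.
HONEST READING: the input a polylogarithmic rate would need (memo §7.4–§7.5) is `(X2)` with `c` a CONSTANT (indeed `≤ const·δ²`)
along a polynomial aspect `M = ⌈m^A⌉`; the calibration says exactly how far the tree's provable exponents are from it: the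
non-uniqueness exponent `a` (tree: `1/220`; print: Cerf's `12/23`-type; numerics ≈ 1.86) must exceed the half-space one-arm
exponent `b` in a LOWER bound `P(halfSpaceArm 3 M) ≥ c' M^{-b}` (tree: `b = 2`; numerics ≈ 0.96).  Nothing here claims
`(X2)` with a constant; by memo §7.0 even that would not change the rate class of the lane's theorem without the second
missing input (N-b).  An explicit function and nothing more.
-/

noncomputable section

namespace Summit.CriticalPhenomena.PercolationContinuityZ3.Theorems.Quant

open MeasureTheory Literature.Probability.LatticeModels Literature.Probability.Percolation
open Literature.Probability.Percolation.AKN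

/-- The QUANT lane's half-space arm event in `d = 3` IS the event `armH` of the crux `QuantitativeBGN`
(`Theorems/QuantitativeBGN/Negative/ArmLowerBound.lean`), definitionally.
builds on p205010 (kernel theorem, internal audit signed; external expert review pending). [folklore] -/
theorem halfSpaceArm_three_eq_armH (M : ℕ) : halfSpaceArm 3 M = QuantitativeBGN.Negative.armH M := rfl

/-- **Half-space one-arm floor at `p_c(ℤ³)` in the lane's vocabulary**: `1/(588 M²) ≤ P_{p_c}(halfSpaceArm 3 M)` for `M ≥ 1`
(`QuantitativeBGN.Negative.armH_lower_bound`, i.e. `φ_{p_c}(Λ_M) ≥ 1` + the face isomorphism).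
builds on p205010 (kernel theorem, internal audit signed; external expert review pending). [folklore] -/
theorem real_halfSpaceArm_three_criticalProbI_ge {M : ℕ} (hM : 1 ≤ M) :
    1 / (588 * (M : ℝ) ^ 2) ≤ (bondPercolation (zdGraph 3) (criticalProbI 3)).real (halfSpaceArm 3 M) := by
  obtain ⟨n, rfl⟩ := Nat.exists_eq_add_of_le' hM
  rw [halfSpaceArm_three_eq_armH]
  push_cast
  exact QuantitativeBGN.Negative.armH_lower_bound n

/-- **The "provable floor" route to `(X2)`**: an ABSOLUTE bound `P_{p_c}((uniqZone m M)ᶜ) ≤ c/(588 M²)` (`M ≥ 1`, `0 ≤ c`)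
implies `TwoArmVsHalfSpaceArmAt 3 p_c m M c`.  With `c` constant the hypothesis is a box-two-arm exponent `> 2`, which is
NOT expected in `d = 3` (memo §7.6 row 1l; postcont QUANT §13(a)): recorded so that the planner does not file that form.
builds on p205010 (kernel theorem, internal audit signed; external expert review pending). [folklore] -/
theorem twoArmVsHalfSpaceArmAt_three_criticalProbI_of_le {m M : ℕ} (hM : 1 ≤ M) {c : ℝ} (hc : 0 ≤ c)
    (h : (bondPercolation (zdGraph 3) (criticalProbI 3)).real (uniqZone (d := 3) m M)ᶜ ≤ c / (588 * (M : ℝ) ^ 2)) :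
    TwoArmVsHalfSpaceArmAt 3 (criticalProbI 3) m M c := by
  unfold TwoArmVsHalfSpaceArmAt
  refine h.trans ?_
  rw [div_eq_mul_one_div]
  exact mul_le_mul_of_nonneg_left (real_halfSpaceArm_three_criticalProbI_ge hM) hc

/-- **Calibration of `(X2)` at `p_c(ℤ³)` against the tree's explicit bounds**: for `M ≥ dktN1 3 (critDelta 3)` and
`m ≤ ⌊M^{dktAlpha 3}⌋` (`dktAlpha 3 = 1/220`), `(X2)` holds at `(m, M)` with the GROWING constant `c(M) = 588 · M^{2 − dktAlpha 3}`:
DKT Prop 1 explicit (`Quant.dkt_criticalProbI_explicit`: `P_{p_c}((uniqZone m M)ᶜ) ≤ M^{-α}`) over the half-space floor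
`P_{p_c}(halfSpaceArm 3 M) ≥ 1/(588 M²)`.  The open input is the same inequality with `c` bounded; the exponent gap to close is
`2 − 1/220` (tree) — numerically the true gap has the other sign (≈ 0.96 − 1.86).  An explicit function and nothing more.
builds on p205010 (kernel theorem, internal audit signed; external expert review pending). [folklore] -/
theorem twoArmVsHalfSpaceArmAt_three_criticalProbI_dkt {m M : ℕ} (hM : dktN1 3 (critDelta 3) ≤ M)
    (hm : m ≤ ⌊(M : ℝ) ^ dktAlpha 3⌋₊) :
    TwoArmVsHalfSpaceArmAt 3 (criticalProbI 3) m M (588 * (M : ℝ) ^ (2 - dktAlpha 3)) := by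
  have hM81 : 81 ≤ M := le_trans (le_max_left _ _) hM
  have hM1 : 1 ≤ M := le_trans (by norm_num) hM81
  have hMpos : (0 : ℝ) < M := by exact_mod_cast (show 0 < M by omega)
  have hdkt := dkt_criticalProbI_explicit (d := 3) (by norm_num) M hM m hm
  refine twoArmVsHalfSpaceArmAt_three_criticalProbI_of_le hM1 (by positivity) (hdkt.trans (le_of_eq ?_))
  -- `M^{-α} = 588 M^{2-α} / (588 M²)`
  rw [Real.rpow_sub hMpos, Real.rpow_neg hMpos.le, Real.rpow_two]
  field_simp

end Summit.CriticalPhenomena.PercolationContinuityZ3.Theorems.Quant
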